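import Literature.NumberTheory.LFunctions.SiegelZeroFormSumAsymptotic
import Literature.NumberTheory.QuadraticFields.ChowlaSelbergFormula
import Literature.NumberTheory.LFunctions.DeuringPhenomenonElementaryTheoremOneProofs
import Literature.NumberTheory.LFunctions.GoldfeldSchinzelLowerHalfExplicit
import HarnessLib

/-!
# Goldfeld 1975, Theorem 1 (`d < 0`) — PROVED: the Siegel zero as
# `1 − β = (6/π²)(L(1,χ) + O((1−β)² log³|d|))/(Σ_{a,b,c} 1/a + O(L(1,χ) log|d|))`
# `= (L(1,χ) + O((1−β)² log³|d|))/L'(1,χ)`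

Topic `Literature/NumberTheory/LFunctions` (namespace `Literature.NumberTheory.LFunctions`, auxiliary
lemmas in `GoldfeldSchinzel1975` as in the statement file). PROOF LAYER (theorems only: no definitions,
no named facts, debt −1) for `SiegelZeroFormSumAsymptotic.lean`: the discharge
`goldfeld1975_theorem1_holds : goldfeld1975_theorem1` of [Goldfeld1975SiegelZeroClassNumber, Theorem 1
p. 612, first two displays], exactly as typed there (cell `parity-realchar`, conditionals column I.17;
cross-ladder literature-typing seat `littype-FP2-1`).

## The printed statement and proof (source read first-hand, Numdam scan pp. 611–615)

p. 612: "THEOREM 1. Let `d < 0`. If the Siegel zero `β` exists, then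
`1 − β = (6/π²){L(1,χ) + O(1 − β)²(log|d|)³}{Σ_{a,b,c} 1/a + O(L(1,χ) log|d|)}⁻¹`,
`1 − β = (L(1,χ) + O(1 − β)²(log|d|)³) L′(1,χ)⁻¹`, [`L′(1,χ) = −(π/√|d|) Σ χ(m) log Γ(m/|d|) +
h(d)π(γ + log 2π)/√|d|`,] where `γ` is Euler's constant, and all other constants occuring in the
`O`-symbols are effectively computable." pp. 612–613, §2: "Following a suggestion of Gallagher, a
simple proof of Theorem (1) can be given by use of Kronecker's limit formula. [(3): the Chowla–Selberg
expansion of `f(z, s) = y^s Σ' |m + nz|^{−2s}`] Now, by a classical theorem of Dirichlet (for `d < 0`)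
(4) `ζ(s)L(s,χ) = ½ Σ_{a,b,c} 2^s|d|^{−s/2} f(z, s)`, `z = (b + √d)/2a`, and by equations (3) and (4)
(5) `lim_{s→1} (ζ(s)L(s,χ) − L(1,χ)/(s − 1)) = γL(1,χ) + L′(1,χ) = (π²/6) Σ_{a,b,c} 1/a + O(L(1,χ) log|d|)`.
On the other hand, the Taylor series expansion for `L` about `β` gives
(6) `0 = L(1,χ) + (β − 1)L′(1,χ) + O(1 − β)²(log|d|)³`. The first part of Theorem 1 now follows from
(5) and (6). The second part follows from (6) and the formula for `L′(1,χ)`."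

## The road (the printed one, on the tree's Kronecker limit formula)

* `GoldfeldSchinzel1975.norm_two_deriv_LFunction_sub_le` — the printed (5) in bounded form:
  `‖2L′(1,χ) − (π²/3)Σ_Q 1/a_Q‖ ≤ (h/√d)(C + 2π log d) + 2γ‖L(1,χ)‖`, from the tree's
  `ChowlaSelberg.sum_epsteinZeta_eq` (`Σ_Q Z_Q(s) = 2ζ(s)L(s,χ)`, the printed (4)),
  `ChowlaSelberg.tendsto_two_mul_zeta_mul_LFunction_sub` (`2ζL − 2L(1)/(s−1) → 2γL(1) + 2L′(1)`),
  `ChowlaSelberg.LFunction_one_and_deriv_eq` (`2L(1,χ) = h·2π/√d`) and the bounded Kronecker limit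
  formula `KroneckerLimit.exists_norm_constantTerm_sub_le` (`‖C_Q − (π²/(3a) − (2π/√d) log(d/a))‖ ≤ C/√d`
  for reduced `Q`, the printed (3)); `GoldfeldSchinzel1975.abs_main_sub_formSum_le` turns it into
  `|θ₂| = |(6/π²)L′(1,χ) − Σ_Q 1/a_Q| ≤ A·L(1,χ)·log d` (`L(1,χ) = πh/√d`);
* `GoldfeldSchinzel1975.abs_re_sub_mul_deriv_re_le` — the printed (6):
  `|L(1,χ) − (1−β)L′(1,χ)| ≤ 1269(1−β)² log³D` at a real zero `β` with `1 − β ≤ 1/(3 log D)`, from the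
  tree's mean value inequality `Pintz1976Deuring.norm_LFunction_sub_sub_le` (`‖L″‖ ≤ 1269 log³q`);
* `goldfeld1975_theorem1_holds` — `θ₁ = θ₃ = (1−β)L′(1) − L(1)`, `θ₂ = (6/π²)L′(1) − S`; the division
  by `L′(1,χ)` (implicit in print) is justified by `L′(1,χ) > 0`, obtained from the tree's lower half of
  Goldfeld–Schinzel's Theorem 1, `ClassSumRepulsion.goldfeldSchinzel_lower_explicit`
  (`(6/π²)L(1) < (1−β)(1+5(1−β))S`), which gives `|θ₂| < S/2` once `(1−β) log D < c₁`. Constants: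
  `c₁ = min(1/10, 1/(5(A+1)))`, `C = max(1269, A)`, `D₀ = 8` ("the Siegel zero" = any real zero in
  `(1 − c₁/log|d|, 1)`, as typed).

LABEL (cell rule): conditionals column I.17, kernel, hypothesis-free. WHAT THIS IS NOT: not Theorem 2
(`d > 0`, continued-fraction quantity `Q`) of the same paper (not typed); nothing on Goldfeld–Schinzel's
Theorem 1 / Lemma 1 / Corollary; nothing here bears on parity (H5). No definitions, no instances, no
notation, no axioms.

## References

* [Goldfeld1975SiegelZeroClassNumber] D. M. Goldfeld, *An asymptotic formula relating the Siegel zero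
  and the class number of quadratic fields*, Ann. Scuola Norm. Sup. Pisa Cl. Sci. (4) **2** (1975)
  611–615: Theorem 1 p. 612, §2 pp. 612–613 ((3)–(6)).
* [SelbergChowla1967] A. Selberg, S. Chowla, *On Epstein's zeta-function*, J. reine angew. Math. 227
  (1967) 86–110, §2 (Kronecker's limit formula; the tree's `ChowlaSelbergFormula.lean`).
* [GranvilleStark2000] A. Granville, H. M. Stark, Invent. Math. 139 (2000), §3.2 eq. (11) (the bounded
  form in the tree's `EpsteinZetaKroneckerLimit.lean`).
-/

noncomputable section

open Complex Filter Topology Finset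
open scoped Real

open Literature.Barriers.RiemannHypothesis (epsteinZeta IsPosDefForm)
open Literature.NumberTheory.QuadraticFields.BinaryQuadraticForm (reducedForms mem_reducedForms_iff
  discr_apply IsReduced)
open Literature.NumberTheory.QuadraticFields.KroneckerLimit (exists_norm_constantTerm_sub_le
  exp_neg_two_pi_starkK_le_half)
open Literature.NumberTheory.QuadraticFields.ChowlaSelberg (four_mul_sub_sq_eq_of_mem
  isPosDefForm_of_mem sum_epsteinZeta_eq tendsto_two_mul_zeta_mul_LFunction_sub
  LFunction_one_and_deriv_eq)

namespace Literature.NumberTheory.LFunctions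

namespace GoldfeldSchinzel1975

/-- A reduced form `(a, b, c)` of discriminant `−d` has `1 ≤ a ≤ d` (`3a² ≤ 4ac − b² = d`).
[cite: Cox2013, §2.A (2.7)–(2.8)] -/
theorem one_le_fst_le_of_mem {d : ℕ} (hd : 0 < d) {Q : ℤ × ℤ × ℤ}
    (hQ : Q ∈ reducedForms (-(d : ℤ))) : (1 : ℝ) ≤ Q.1 ∧ (Q.1 : ℝ) ≤ d := by
  have hD : (-(d : ℤ)) < 0 := by omega
  obtain ⟨hdisc, ha, -, hred⟩ := (mem_reducedForms_iff hD).1 hQ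
  obtain ⟨hb1, hb2, hac, -⟩ := hred
  obtain ⟨a, b, c⟩ := Q
  rw [discr_apply] at hdisc
  simp only at ha hb1 hb2 hac hdisc ⊢
  refine ⟨by exact_mod_cast ha, ?_⟩
  have hb : b ^ 2 ≤ a ^ 2 := by nlinarith
  have h3 : 3 * a ^ 2 ≤ (d : ℤ) := by nlinarith
  have : a ≤ (d : ℤ) := by nlinarith
  exact_mod_cast this

/-- **Kronecker's limit formula summed over the classes, bounded form**: for the odd real primitive
character `χ` mod `d > 4`, with `h = #reducedForms(−d)`,
`‖2L'(1, χ) − (π²/3) Σ_Q 1/a_Q‖ ≤ (h/√d)(C + 2π log d) + 2γ‖L(1, χ)‖` for an absolute `C ≥ 0`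
(from `Σ_Q Z_Q(s) = 2ζ(s)L(s, χ)`, the class number formula `2L(1, χ) = h·2π/√d`, Mathlib's
`ζ(s) − 1/(s − 1) → γ`, and the tree's bounded Kronecker limit formula
`‖C_Q − (π²/(3a) − (2π/√d) log(d/a))‖ ≤ C/√d` for every reduced `Q = (a, b, c)`).
[cite: Goldfeld1975SiegelZeroClassNumber, §2 (Kronecker's limit formula)]
[cite: GranvilleStark2000, §3.2 eq. (11)] -/
theorem norm_two_deriv_LFunction_sub_le :
    ∃ C : ℝ, 0 ≤ C ∧ ∀ (d : ℕ) [NeZero d] (χ : DirichletCharacter ℂ d), 4 < d → χ.IsPrimitive →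
      χ.IsQuadratic → χ.Odd →
        ‖2 * deriv χ.LFunction 1 -
            ((π ^ 2 / 3 * ∑ Q ∈ reducedForms (-(d : ℤ)), (1 : ℝ) / (Q.1 : ℝ) : ℝ) : ℂ)‖ ≤
          ((reducedForms (-(d : ℤ))).card : ℝ) / Real.sqrt d * (C + 2 * π * Real.log d) +
            2 * Real.eulerMascheroniConstant * ‖χ.LFunction 1‖ := by
  obtain ⟨C, hC⟩ := exists_norm_constantTerm_sub_le
  refine ⟨max C 0, le_max_right _ _, ?_⟩
  intro d _ χ hd4 hprim hquad hodd
  have hd : 0 < d := by omega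
  have hdR : (0 : ℝ) < d := by exact_mod_cast hd
  have hsq : 0 < Real.sqrt d := Real.sqrt_pos.mpr hdR
  have hχ1 : χ ≠ 1 := OddCharLogDeriv.ne_one_of_odd hodd
  have hγ : 0 ≤ Real.eulerMascheroniConstant :=
    (one_half_pos.trans Real.one_half_lt_eulerMascheroniConstant).le
  set RF := reducedForms (-(d : ℤ)) with hRF
  set c : ℂ := ((2 * π / Real.sqrt d : ℝ) : ℂ) with hc
  -- the constant terms `CT_Q` of the classes, with Kronecker's bound
  have key : ∀ Q ∈ RF, ∃ CT : ℂ,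
      Tendsto (fun s : ℝ => epsteinZeta (Q.1 : ℝ) (Q.2.1 : ℝ) (Q.2.2 : ℝ) s - c / ((s : ℂ) - 1))
        (𝓝[>] 1) (𝓝 CT) ∧
      ‖CT - ((π ^ 2 / (3 * (Q.1 : ℝ)) - (2 * π / Real.sqrt d) * Real.log ((d : ℝ) / Q.1) : ℝ) : ℂ)‖ ≤
        C / Real.sqrt d := by
    intro Q hQ
    have hpd := isPosDefForm_of_mem hd hQ
    obtain ⟨ha, h4⟩ := four_mul_sub_sq_eq_of_mem hd hQ
    have hDneg : (-(d : ℤ)) < 0 := by omega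
    obtain ⟨-, -, -, hred⟩ := (mem_reducedForms_iff hDneg).1 hQ
    obtain ⟨hb1, hb2, hac, -⟩ := hred
    have hb1R : -(Q.1 : ℝ) ≤ (Q.2.1 : ℝ) := by exact_mod_cast hb1
    have hb2R : (Q.2.1 : ℝ) ≤ (Q.1 : ℝ) := by exact_mod_cast hb2
    have hba : |(Q.2.1 : ℝ)| ≤ (Q.1 : ℝ) := abs_le.mpr ⟨hb1R, hb2R⟩
    have hac' : (Q.1 : ℝ) ≤ (Q.2.2 : ℝ) := by exact_mod_cast hac
    have hη := exp_neg_two_pi_starkK_le_half hpd hba hac'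
    obtain ⟨CT, hT, hB⟩ := hC _ _ _ hpd hη
    rw [h4] at hT hB
    exact ⟨CT, hT, hB⟩
  choose! CT hCT1 hCT2 using key
  -- the summed limit and the Laurent data of `2ζL`
  have T1 : Tendsto (fun s : ℝ => ∑ Q ∈ RF,
      (epsteinZeta (Q.1 : ℝ) (Q.2.1 : ℝ) (Q.2.2 : ℝ) s - c / ((s : ℂ) - 1))) (𝓝[>] 1)
      (𝓝 (∑ Q ∈ RF, CT Q)) :=
    tendsto_finsetSum RF fun Q hQ => hCT1 Q hQ
  have T2 := tendsto_two_mul_zeta_mul_LFunction_sub hχ1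
  obtain ⟨hfirst, -⟩ := LFunction_one_and_deriv_eq hprim hquad hodd hd4
  have T3 := T1.sub T2
  have heq : (fun s : ℝ => (∑ Q ∈ RF,
        (epsteinZeta (Q.1 : ℝ) (Q.2.1 : ℝ) (Q.2.2 : ℝ) s - c / ((s : ℂ) - 1))) -
      (2 * riemannZeta s * χ.LFunction s - 2 * χ.LFunction 1 / ((s : ℂ) - 1))) =ᶠ[𝓝[>] 1]
      fun _ => (0 : ℂ) := by
    filter_upwards [self_mem_nhdsWithin] with s hs
    have hs' : 1 < ((s : ℂ)).re := by simpa using hs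
    rw [Finset.sum_sub_distrib, sum_epsteinZeta_eq hprim hquad hodd hd4 hs', Finset.sum_const,
      nsmul_eq_mul, hfirst, hc]
    ring
  have T4 := T3.congr' heq
  have hlim : ∑ Q ∈ RF, CT Q -
      (2 * (Real.eulerMascheroniConstant : ℂ) * χ.LFunction 1 + 2 * deriv χ.LFunction 1) = 0 :=
    tendsto_nhds_unique T4 tendsto_const_nhds
  have hderiv : 2 * deriv χ.LFunction 1 =
      ∑ Q ∈ RF, CT Q - 2 * (Real.eulerMascheroniConstant : ℂ) * χ.LFunction 1 := by
    linear_combination -hlim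
  -- regroup: `2L' − (π²/3)S = Σ_Q (CT_Q − main_Q) − Σ_Q c log(d/a_Q) − 2γ L(1)`
  set mainT : ℤ × ℤ × ℤ → ℂ := fun Q =>
    ((π ^ 2 / (3 * (Q.1 : ℝ)) - (2 * π / Real.sqrt d) * Real.log ((d : ℝ) / Q.1) : ℝ) : ℂ)
    with hmainT
  set logT : ℤ × ℤ × ℤ → ℂ := fun Q => (((2 * π / Real.sqrt d) * Real.log ((d : ℝ) / Q.1) : ℝ) : ℂ)
    with hlogT
  have hsplit : 2 * deriv χ.LFunction 1 -
      ((π ^ 2 / 3 * ∑ Q ∈ RF, (1 : ℝ) / (Q.1 : ℝ) : ℝ) : ℂ) =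
      ∑ Q ∈ RF, (CT Q - mainT Q) - ∑ Q ∈ RF, logT Q -
        2 * (Real.eulerMascheroniConstant : ℂ) * χ.LFunction 1 := by
    rw [hderiv, Finset.mul_sum, ofReal_sum, Finset.sum_sub_distrib]
    have hre : ∑ Q ∈ RF, mainT Q = ∑ Q ∈ RF, ((π ^ 2 / 3 * ((1 : ℝ) / (Q.1 : ℝ)) : ℝ) : ℂ) -
        ∑ Q ∈ RF, logT Q := by
      rw [← Finset.sum_sub_distrib]
      refine Finset.sum_congr rfl fun Q hQ => ?_
      have ha : (Q.1 : ℝ) ≠ 0 := by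
        have := (one_le_fst_le_of_mem hd hQ).1; positivity
      rw [hmainT, hlogT]
      push_cast
      field_simp
    rw [hre]
    ring
  -- the three pieces
  have hcard0 : (0 : ℝ) ≤ (RF.card : ℝ) := by positivity
  have h1 : ‖∑ Q ∈ RF, (CT Q - mainT Q)‖ ≤ (RF.card : ℝ) * (max C 0 / Real.sqrt d) := by
    calc ‖∑ Q ∈ RF, (CT Q - mainT Q)‖ ≤ ∑ Q ∈ RF, ‖CT Q - mainT Q‖ := norm_sum_le _ _
      _ ≤ ∑ Q ∈ RF, max C 0 / Real.sqrt d := by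
          refine Finset.sum_le_sum fun Q hQ => ?_
          exact (hCT2 Q hQ).trans (div_le_div_of_nonneg_right (le_max_left _ _) hsq.le)
      _ = (RF.card : ℝ) * (max C 0 / Real.sqrt d) := by rw [Finset.sum_const, nsmul_eq_mul]
  have h2 : ‖∑ Q ∈ RF, logT Q‖ ≤ (RF.card : ℝ) * (2 * π / Real.sqrt d * Real.log d) := by
    calc ‖∑ Q ∈ RF, logT Q‖ ≤ ∑ Q ∈ RF, ‖logT Q‖ := norm_sum_le _ _
      _ ≤ ∑ Q ∈ RF, 2 * π / Real.sqrt d * Real.log d := by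
          refine Finset.sum_le_sum fun Q hQ => ?_
          obtain ⟨ha1, had⟩ := one_le_fst_le_of_mem hd hQ
          have ha0 : (0 : ℝ) < Q.1 := by linarith
          have hl0 : 0 ≤ Real.log ((d : ℝ) / Q.1) := Real.log_nonneg ((one_le_div ha0).mpr had)
          have hl1 : Real.log ((d : ℝ) / Q.1) ≤ Real.log d := by
            rw [Real.log_div hdR.ne' ha0.ne']
            linarith [Real.log_nonneg ha1]
          rw [hlogT]
          simp only
          rw [Complex.norm_real, Real.norm_of_nonneg (by positivity)]
          exact mul_le_mul_of_nonneg_left hl1 (by positivity)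
      _ = (RF.card : ℝ) * (2 * π / Real.sqrt d * Real.log d) := by
          rw [Finset.sum_const, nsmul_eq_mul]
  have h3 : ‖2 * (Real.eulerMascheroniConstant : ℂ) * χ.LFunction 1‖ =
      2 * Real.eulerMascheroniConstant * ‖χ.LFunction 1‖ := by
    rw [norm_mul, norm_mul, Complex.norm_real, Real.norm_of_nonneg hγ, Complex.norm_two]
  rw [hsplit]
  have htri : ‖∑ Q ∈ RF, (CT Q - mainT Q) - ∑ Q ∈ RF, logT Q -
        2 * (Real.eulerMascheroniConstant : ℂ) * χ.LFunction 1‖ ≤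
      ‖∑ Q ∈ RF, (CT Q - mainT Q)‖ + ‖∑ Q ∈ RF, logT Q‖ +
        ‖2 * (Real.eulerMascheroniConstant : ℂ) * χ.LFunction 1‖ :=
    (norm_sub_le _ _).trans (add_le_add (norm_sub_le _ _) le_rfl)
  refine htri.trans ?_
  rw [h3]
  have e : (RF.card : ℝ) * (max C 0 / Real.sqrt d) +
      (RF.card : ℝ) * (2 * π / Real.sqrt d * Real.log d) =
      (RF.card : ℝ) / Real.sqrt d * (max C 0 + 2 * π * Real.log d) := by
    field_simp
  linarith [h1, h2, e]


/-- `log d ≥ 1` for `d ≥ 3`. [folklore] -/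
private theorem one_le_log_of_three_le {d : ℕ} (hd : 3 ≤ d) : (1 : ℝ) ≤ Real.log d := by
  have hd' : (3 : ℝ) ≤ d := by exact_mod_cast hd
  rw [Real.le_log_iff_exp_le (by linarith)]
  exact (Real.exp_one_lt_d9.le.trans (by norm_num)).trans hd'

/-- **Goldfeld's `θ₂`**: for the odd real primitive character `χ` mod `d > 4` and
`S = Σ_{Q reduced} 1/a_Q`, `|(6/π²) L'(1, χ) − S| ≤ A · L(1, χ) · log d` with an absolute `A ≥ 0`
(from `norm_two_deriv_LFunction_sub_le` and `L(1, χ) = πh/√d`).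
[cite: Goldfeld1975SiegelZeroClassNumber, Theorem 1 p. 612 (first display), §2] -/
theorem abs_main_sub_formSum_le :
    ∃ A : ℝ, 0 ≤ A ∧ ∀ (d : ℕ) [NeZero d] (χ : DirichletCharacter ℂ d), 4 < d → χ.IsPrimitive →
      χ.IsQuadratic → χ.Odd →
        0 < (χ.LFunction 1).re ∧
        |6 / π ^ 2 * (deriv χ.LFunction 1).re - ∑ Q ∈ reducedForms (-(d : ℤ)), (1 : ℝ) / (Q.1 : ℝ)| ≤
          A * (χ.LFunction 1).re * Real.log d := by
  obtain ⟨CK, hCK0, hK⟩ := norm_two_deriv_LFunction_sub_le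
  have hγ0 : 0 ≤ Real.eulerMascheroniConstant :=
    (one_half_pos.trans Real.one_half_lt_eulerMascheroniConstant).le
  have hπ0 := Real.pi_pos
  refine ⟨3 / π ^ 2 * (CK / π + 2 + 2 * Real.eulerMascheroniConstant), by positivity, ?_⟩
  intro d _ χ hd4 hprim hquad hodd
  have hdR : (0 : ℝ) < d := by exact_mod_cast (show 0 < d by omega)
  have hsq : 0 < Real.sqrt d := Real.sqrt_pos.mpr hdR
  have hlog1 : 1 ≤ Real.log d := one_le_log_of_three_le (by omega)
  obtain ⟨hfirst, -⟩ := LFunction_one_and_deriv_eq hprim hquad hodd hd4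
  set RF := reducedForms (-(d : ℤ)) with hRF
  set S : ℝ := ∑ Q ∈ RF, (1 : ℝ) / (Q.1 : ℝ) with hS
  have hL1 : χ.LFunction 1 = (((RF.card : ℝ) * π / Real.sqrt d : ℝ) : ℂ) := by
    have h := hfirst
    push_cast at h ⊢
    linear_combination h / 2
  have hre : (χ.LFunction 1).re = (RF.card : ℝ) * π / Real.sqrt d := by
    rw [hL1, Complex.ofReal_re]
  have hnorm : ‖χ.LFunction 1‖ = (χ.LFunction 1).re := by
    rw [hre, hL1, Complex.norm_real, Real.norm_of_nonneg (by positivity)]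
  have hre0 : 0 ≤ (χ.LFunction 1).re := by rw [hre]; positivity
  have hχ1 : χ ≠ 1 := OddCharLogDeriv.ne_one_of_odd hodd
  have hL10 : χ.LFunction 1 ≠ 0 :=
    DirichletCharacter.LFunction_ne_zero_of_one_le_re χ (Or.inl hχ1) (by simp)
  have hre_pos : 0 < (χ.LFunction 1).re := by
    rcases hre0.lt_or_eq with h | h
    · exact h
    · exfalso
      apply hL10
      rw [← Complex.re_add_im (χ.LFunction 1), ← h]
      have him : (χ.LFunction 1).im = 0 := by rw [hL1, Complex.ofReal_im]
      rw [him]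
      simp
  refine ⟨hre_pos, ?_⟩
  have hKD := hK d χ hd4 hprim hquad hodd
  have hre2 : (2 * deriv χ.LFunction 1 - ((π ^ 2 / 3 * S : ℝ) : ℂ)).re =
      2 * (deriv χ.LFunction 1).re - π ^ 2 / 3 * S := by
    rw [Complex.sub_re, Complex.ofReal_re]
    simp [Complex.mul_re]
  have h1 := Complex.abs_re_le_norm (2 * deriv χ.LFunction 1 - ((π ^ 2 / 3 * S : ℝ) : ℂ))
  rw [hre2] at h1
  have h2 := h1.trans hKD
  have h3 : (RF.card : ℝ) / Real.sqrt d = (χ.LFunction 1).re / π := by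
    rw [hre]; field_simp
  rw [h3, hnorm] at h2
  have hθ : 6 / π ^ 2 * (deriv χ.LFunction 1).re - S =
      3 / π ^ 2 * (2 * (deriv χ.LFunction 1).re - π ^ 2 / 3 * S) := by
    field_simp
    ring
  rw [hθ, abs_mul, abs_of_pos (by positivity : (0 : ℝ) < 3 / π ^ 2)]
  have h4 : (χ.LFunction 1).re / π * (CK + 2 * π * Real.log d) +
      2 * Real.eulerMascheroniConstant * (χ.LFunction 1).re ≤
      (CK / π + 2 + 2 * Real.eulerMascheroniConstant) * (χ.LFunction 1).re * Real.log d := by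
    have e : (χ.LFunction 1).re / π * (CK + 2 * π * Real.log d) +
        2 * Real.eulerMascheroniConstant * (χ.LFunction 1).re =
        CK / π * (χ.LFunction 1).re + 2 * (χ.LFunction 1).re * Real.log d +
          2 * Real.eulerMascheroniConstant * (χ.LFunction 1).re := by
      field_simp
    rw [e]
    have i1 : CK / π * (χ.LFunction 1).re ≤ CK / π * (χ.LFunction 1).re * Real.log d :=
      le_mul_of_one_le_right (by positivity) hlog1
    have i2 : 2 * Real.eulerMascheroniConstant * (χ.LFunction 1).re ≤
        2 * Real.eulerMascheroniConstant * (χ.LFunction 1).re * Real.log d :=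
      le_mul_of_one_le_right (by positivity) hlog1
    nlinarith
  calc 3 / π ^ 2 * |2 * (deriv χ.LFunction 1).re - π ^ 2 / 3 * S|
      ≤ 3 / π ^ 2 * ((χ.LFunction 1).re / π * (CK + 2 * π * Real.log d) +
          2 * Real.eulerMascheroniConstant * (χ.LFunction 1).re) :=
        mul_le_mul_of_nonneg_left h2 (by positivity)
    _ ≤ 3 / π ^ 2 * ((CK / π + 2 + 2 * Real.eulerMascheroniConstant) *
          (χ.LFunction 1).re * Real.log d) := mul_le_mul_of_nonneg_left h4 (by positivity)
    _ = _ := by ring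

/-- **Goldfeld's `θ₃`** (Taylor at `s = 1`): at a real zero `β` with `1 − β ≤ 1/(3 log D)` of `L(s, χ)`,
`χ ≠ 1` mod `D ≥ 3`, `log D ≥ 2`: `|L(1, χ) − (1 − β)L'(1, χ)| ≤ 1269 (1 − β)² log³D` (real parts),
from the tree's mean value inequality `Pintz1976Deuring.norm_LFunction_sub_sub_le` (`‖L″‖ ≤ 1269 log³q`).
[cite: Goldfeld1975SiegelZeroClassNumber, Theorem 1 p. 612 (second display)] -/
theorem abs_re_sub_mul_deriv_re_le {D : ℕ} [NeZero D] (χ : DirichletCharacter ℂ D) (hχ : χ ≠ 1)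
    (hD3 : 3 ≤ D) (hlog2 : 2 ≤ Real.log D) {β : ℝ} (hβ1 : β < 1)
    (hρ : 1 - β ≤ 1 / (3 * Real.log D)) (hz : χ.LFunction (β : ℂ) = 0) :
    |(χ.LFunction 1).re - (1 - β) * (deriv χ.LFunction 1).re| ≤
      1269 * (1 - β) ^ 2 * Real.log D ^ 3 := by
  have hδ0 : 0 < 1 - β := by linarith
  have hs₁ : ‖(β : ℂ) - 1‖ ≤ 1 - β := by
    rw [show (β : ℂ) - 1 = ((β - 1 : ℝ) : ℂ) by push_cast; ring, Complex.norm_real,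
      Real.norm_eq_abs, abs_of_nonpos (by linarith)]
    linarith
  have hs₂ : ‖(1 : ℂ) - 1‖ ≤ 1 - β := by rw [sub_self, norm_zero]; exact hδ0.le
  have hT := Pintz1976Deuring.norm_LFunction_sub_sub_le χ hχ hD3 hlog2 hρ hs₁ hs₂
  rw [hz, sub_zero] at hT
  have hn1 : ‖(1 : ℂ) - (β : ℂ)‖ = 1 - β := by
    rw [show (1 : ℂ) - β = ((1 - β : ℝ) : ℂ) by push_cast; ring, Complex.norm_real,
      Real.norm_of_nonneg hδ0.le]
  rw [hn1] at hT
  have hEre : (χ.LFunction 1 - (1 - (β : ℂ)) * deriv χ.LFunction 1).re =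
      (χ.LFunction 1).re - (1 - β) * (deriv χ.LFunction 1).re := by
    rw [Complex.sub_re, show (1 : ℂ) - β = ((1 - β : ℝ) : ℂ) by push_cast; ring,
      Complex.re_ofReal_mul]
  rw [← hEre]
  calc |(χ.LFunction 1 - (1 - (β : ℂ)) * deriv χ.LFunction 1).re|
      ≤ ‖χ.LFunction 1 - (1 - (β : ℂ)) * deriv χ.LFunction 1‖ := Complex.abs_re_le_norm _
    _ ≤ 1269 * Real.log D ^ 3 * (1 - β) * (1 - β) := hT
    _ = 1269 * (1 - β) ^ 2 * Real.log D ^ 3 := by ring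

end GoldfeldSchinzel1975

open GoldfeldSchinzel1975 in
/-- **Goldfeld 1975, Theorem 1 (`d < 0`) — PROVED (discharge of the named fact `goldfeld1975_theorem1`,
exactly as typed).** With `S = Σ_{Q reduced} 1/a_Q`: the second display
`1 − β = (L(1,χ) + θ₃)/L'(1,χ)`, `|θ₃| ≤ C(1−β)² log³|d|`, is the mean-value form of
`0 = L(β) = L(1) − (1−β)L'(1) + O((1−β)² sup|L″|)` with the tree's `‖L″‖ ≤ 1269 log³q` near `1`
(`abs_re_sub_mul_deriv_re_le`); the first display follows with `θ₁ = θ₃` and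
`θ₂ = (6/π²)L'(1,χ) − S`, where **Kronecker's limit formula** summed over the classes
(`norm_two_deriv_LFunction_sub_le`, `abs_main_sub_formSum_le`: `|θ₂| ≤ A·L(1,χ) log|d|`) is Goldfeld's
§2. The positivity `L'(1,χ) > 0` needed to divide comes from the tree's lower half of
Goldfeld–Schinzel's Theorem 1 (`ClassSumRepulsion.goldfeldSchinzel_lower_explicit`:
`(6/π²)L(1) < (1−β)(1+5(1−β))S`), which makes `|θ₂| < S/2` once `(1 − β) log|d| < c₁`
(`c₁ = min(1/10, 1/(5(A+1)))`, `C = max(1269, A)`, `D₀ = 8`; "the Siegel zero" is any real zero in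
`(1 − c₁/log|d|, 1)`). [cite: Goldfeld1975SiegelZeroClassNumber, Theorem 1 p. 612 (first two displays), §2] -/
theorem goldfeld1975_theorem1_holds : goldfeld1975_theorem1 := by
  obtain ⟨A, hA0, hA⟩ := GoldfeldSchinzel1975.abs_main_sub_formSum_le
  have hπ0 := Real.pi_pos
  have hπ10 : π ^ 2 < 10 := by nlinarith [Real.pi_lt_d2, Real.pi_gt_three]
  refine ⟨min (1 / 10) (1 / (5 * (A + 1))), by positivity, max 1269 A, 8, ?_⟩
  intro D _ hD χ hquad hprim hodd β hβ hβ1 hz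
  have hD8 : (8 : ℝ) ≤ D := by exact_mod_cast hD
  have hD4 : 4 < D := by omega
  have hD3 : 3 ≤ D := by omega
  have hDR : (0 : ℝ) < D := by linarith
  have hlog2 : 2 ≤ Real.log D := by
    rw [Real.le_log_iff_exp_le hDR]
    calc Real.exp 2 = Real.exp 1 ^ 2 := by rw [← Real.exp_nat_mul]; norm_num
      _ ≤ 2.7182818286 ^ 2 := pow_le_pow_left₀ (Real.exp_pos 1).le Real.exp_one_lt_d9.le 2
      _ ≤ 8 := by norm_num
      _ ≤ D := hD8
  have hlog0 : 0 < Real.log D := by linarith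
  have hlog1 : 1 ≤ Real.log D := by linarith
  have hχ1 : χ ≠ 1 := OddCharLogDeriv.ne_one_of_odd hodd
  set c₁ : ℝ := min (1 / 10) (1 / (5 * (A + 1))) with hc₁
  have hc₁0 : 0 < c₁ := by positivity
  have hc₁10 : c₁ ≤ 1 / 10 := min_le_left _ _
  have hc₁A : c₁ ≤ 1 / (5 * (A + 1)) := min_le_right _ _
  -- `1 − β`
  have hδ0 : 0 < 1 - β := by linarith
  have hδ : 1 - β < c₁ / Real.log D := by linarith
  have hδ' : (1 - β) * Real.log D < c₁ := (lt_div_iff₀ hlog0).mp hδ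
  have hδ10 : 1 - β ≤ 1 / 10 := by
    have : c₁ / Real.log D ≤ c₁ := div_le_self hc₁0.le hlog1
    linarith
  have hβ9 : 9 / 10 ≤ β := by linarith
  have hρ : 1 - β ≤ 1 / (3 * Real.log D) := by
    rw [le_div_iff₀ (by positivity)]
    have : (1 - β) * (3 * Real.log D) = 3 * ((1 - β) * Real.log D) := by ring
    rw [this]
    linarith
  -- `S > 0`, Kronecker's `θ₂`, positivity of `L'(1)`
  set S : ℝ := ∑ Q ∈ reducedForms (-(D : ℤ)), (1 : ℝ) / (Q.1 : ℝ) with hS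
  obtain ⟨hre0, hAD⟩ := hA D χ hD4 hprim hquad hodd
  have hGS := ClassSumRepulsion.goldfeldSchinzel_lower_explicit hD4 hprim hquad hodd hβ9 hβ1 hz
  have hprod0 : 0 < (1 - β) * (1 + 5 * (1 - β)) := by positivity
  have hS0 : 0 < S := by
    have h1 : 0 < (1 - β) * (1 + 5 * (1 - β)) * S := lt_trans (by positivity) hGS
    exact (mul_pos_iff_of_pos_left hprod0).mp h1
  have hLre_le : (χ.LFunction 1).re ≤ π ^ 2 / 4 * (1 - β) * S := by
    have h15 : (1 - β) * (1 + 5 * (1 - β)) * S ≤ 3 / 2 * (1 - β) * S := by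
      have : (1 - β) * (1 + 5 * (1 - β)) ≤ 3 / 2 * (1 - β) := by nlinarith
      exact mul_le_mul_of_nonneg_right this hS0.le
    have h := hGS.le.trans h15
    calc (χ.LFunction 1).re = π ^ 2 / 6 * (6 / π ^ 2 * (χ.LFunction 1).re) := by
          field_simp
      _ ≤ π ^ 2 / 6 * (3 / 2 * (1 - β) * S) := mul_le_mul_of_nonneg_left h (by positivity)
      _ = π ^ 2 / 4 * (1 - β) * S := by ring
  set θ₂ : ℝ := 6 / π ^ 2 * (deriv χ.LFunction 1).re - S with hθ₂
  have hθ₂b : |θ₂| ≤ A * (χ.LFunction 1).re * Real.log D := hAD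
  have hθ₂S : |θ₂| < S / 2 := by
    have k1 : |θ₂| ≤ A * (π ^ 2 / 4 * (1 - β) * S) * Real.log D :=
      hθ₂b.trans (mul_le_mul_of_nonneg_right (mul_le_mul_of_nonneg_left hLre_le hA0) hlog0.le)
    have k2 : A * (π ^ 2 / 4 * (1 - β) * S) * Real.log D =
        A * (π ^ 2 / 4) * ((1 - β) * Real.log D) * S := by ring
    have k3 : A * (π ^ 2 / 4) * ((1 - β) * Real.log D) * S ≤ A * (π ^ 2 / 4) * c₁ * S := by
      have := mul_le_mul_of_nonneg_left hδ'.le (by positivity : (0 : ℝ) ≤ A * (π ^ 2 / 4))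
      exact mul_le_mul_of_nonneg_right this hS0.le
    have k4 : A * (π ^ 2 / 4) * c₁ * S ≤ A * (π ^ 2 / 4) * (1 / (5 * (A + 1))) * S :=
      mul_le_mul_of_nonneg_right (mul_le_mul_of_nonneg_left hc₁A (by positivity)) hS0.le
    have k5 : A * (π ^ 2 / 4) * (1 / (5 * (A + 1))) * S < S / 2 := by
      rw [show A * (π ^ 2 / 4) * (1 / (5 * (A + 1))) * S = S * (A * π ^ 2 / (20 * (A + 1))) by
        field_simp; ring, show S / 2 = S * (1 / 2) by ring]
      refine mul_lt_mul_of_pos_left ?_ hS0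
      rw [div_lt_div_iff₀ (by positivity) (by norm_num)]
      nlinarith
    linarith
  have hL'pos : 0 < (deriv χ.LFunction 1).re := by
    have hden : S + θ₂ = 6 / π ^ 2 * (deriv χ.LFunction 1).re := by rw [hθ₂]; ring
    have h' : 0 < S + θ₂ := by
      have := neg_abs_le θ₂
      linarith
    rw [hden] at h'
    exact (mul_pos_iff_of_pos_left (by positivity)).mp h'
  -- Taylor: `θ₃`
  have hT := abs_re_sub_mul_deriv_re_le χ hχ1 hD3 hlog2 hβ1 hρ hz
  set θ₃ : ℝ := (1 - β) * (deriv χ.LFunction 1).re - (χ.LFunction 1).re with hθ₃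
  have hθ₃b : |θ₃| ≤ 1269 * (1 - β) ^ 2 * Real.log D ^ 3 := by
    rw [hθ₃, abs_sub_comm]; exact hT
  have hθ₃eq : 1 - β = ((χ.LFunction 1).re + θ₃) / (deriv χ.LFunction 1).re := by
    rw [eq_div_iff hL'pos.ne', hθ₃]; ring
  -- assemble
  have hC2 : A ≤ max 1269 A := le_max_right _ _
  have hpow0 : 0 ≤ (1 - β) ^ 2 * Real.log D ^ 3 := by positivity
  have hθ₃C : |θ₃| ≤ max 1269 A * (1 - β) ^ 2 * Real.log D ^ 3 := by
    calc |θ₃| ≤ 1269 * (1 - β) ^ 2 * Real.log D ^ 3 := hθ₃b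
      _ = 1269 * ((1 - β) ^ 2 * Real.log D ^ 3) := by ring
      _ ≤ max 1269 A * ((1 - β) ^ 2 * Real.log D ^ 3) :=
          mul_le_mul_of_nonneg_right (le_max_left _ _) hpow0
      _ = max 1269 A * (1 - β) ^ 2 * Real.log D ^ 3 := by ring
  refine ⟨⟨θ₃, θ₂, hθ₃C, ?_, ?_⟩, ⟨θ₃, hθ₃C, hθ₃eq⟩⟩
  · calc |θ₂| ≤ A * (χ.LFunction 1).re * Real.log D := hθ₂b
      _ = A * ((χ.LFunction 1).re * Real.log D) := by ring
      _ ≤ max 1269 A * ((χ.LFunction 1).re * Real.log D) :=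
          mul_le_mul_of_nonneg_right hC2 (by positivity)
      _ = max 1269 A * (χ.LFunction 1).re * Real.log D := by ring
  · have hden : S + θ₂ = 6 / π ^ 2 * (deriv χ.LFunction 1).re := by rw [hθ₂]; ring
    rw [hden, hθ₃eq]
    field_simp

end Literature.NumberTheory.LFunctions

end
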